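import Literature.MathematicalPhysics.QuantumFieldTheory.ContinuumLimits
import Literature.MathematicalPhysics.QuantumLattice.LatticeGaugeDLRProofs
import Literature.MathematicalPhysics.QuantumLattice.HeatKernelGroupMeasureProofs
import Mathlib.MeasureTheory.Integral.Marginal
import Mathlib.MeasureTheory.Group.LIntegral
import HarnessLib

/-!
# `YM₂` on the lattice torus, II: Haar invariance, the convolution move, marginals

Second sibling proof file of
`Literature/MathematicalPhysics/QuantumFieldTheory/ContinuumLimits.lean` towards
`ym2_exists_heatKernel_holds` (Sengupta, Mem. AMS 600 (1997) Thm 4.2; Driver, CMP 123 (1989)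
§§3–4).  Three groups of tools, all relative to the normalised Haar measure
`haarProbability G` of the compact structure group and the product Haar measure
`Measure.pi fun _ : ι => haarProbability G` on edge configurations `ι → G`:

* bi-invariance of `haarProbability G` (compact groups are unimodular; the right invariance is
  `QuantumLattice.measurePreserving_mul_mul_inv_haarProbability` read as an `IsMulRightInvariant`
  instance), so that Mathlib's `lintegral_mul_left_eq_self` / `lintegral_mul_right_eq_self`
  (valid for *arbitrary* integrands) apply;
* the **convolution move** of two-dimensional lattice gauge theory (Migdal 1975; Driver 1989 §4):
  integrating the variable of an edge shared by two faces with heat-kernel weights merges the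
  faces and adds their areas,
  `∫ p_s(x h y) p_t(x' h⁻¹ y') dh = p_{s+t}(y x y' x')` (semigroup law + centrality);
* bookkeeping lemmas for Mathlib's iterated marginals `∫⋯∫⁻_s, f ∂μ` (`MeasureTheory.lmarginal`)
  over product Haar measure: a function not depending on the integrated coordinates is its own
  marginal, such factors can be pulled out, equal partial marginals give equal integrals, and the
  **renaming move** — a right translation of one coordinate by a function of the others does not
  change the integral.

Everything is proved; no definition or statement is introduced. [folklore]
-/

noncomputable section

open MeasureTheory Filter Topology Function
open scoped ENNReal
open Literature.MathematicalPhysics.QuantumLattice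

namespace Literature.MathematicalPhysics.QuantumFieldTheory.YM2

variable {G : Type*} [Group G] [TopologicalSpace G] [IsTopologicalGroup G] [CompactSpace G]
  [MeasurableSpace G] [BorelSpace G]

/-! ### Bi-invariance of the normalised Haar measure -/

variable (G) in
/-- The normalised Haar measure `haarProbability G = haarMeasure ⊤` is left invariant. [folklore] -/
theorem isMulLeftInvariant_haarProbability : (haarProbability G).IsMulLeftInvariant := by
  rw [haarProbability]
  infer_instance

variable (G) in
/-- The normalised Haar measure of a compact group is right invariant (unimodularity of compact
groups; from `QuantumLattice.measurePreserving_mul_mul_inv_haarProbability`). [folklore] -/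
theorem isMulRightInvariant_haarProbability : (haarProbability G).IsMulRightInvariant := by
  refine ⟨fun g => ?_⟩
  have h := (measurePreserving_mul_mul_inv_haarProbability (G := G) (1 : G) g⁻¹).map_eq
  simp only [one_mul, inv_inv] at h
  exact h

variable (G) in
/-- The normalised Haar measure of a compact group charges open sets. [folklore] -/
theorem isOpenPosMeasure_haarProbability : (haarProbability G).IsOpenPosMeasure := by
  rw [haarProbability]
  infer_instance

/-! ### The convolution move -/

/-- **Convolution move** (Migdal 1975; Driver, CMP 123 (1989) §4), real form: for a heat kernel
`p`, `s, t > 0` and `x y x' y' ∈ G`,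
`∫ p_s(x h y) p_t(x' h⁻¹ y') dh = p_{s+t}(y x y' x')` — by centrality `p_s(x h y) = p_s(y x h)` and
`p_t(x' h⁻¹ y') = p_t(h⁻¹ y' x')`, the substitution `k = y x h` (left invariance) and the semigroup
law `p_{s+t}(g) = ∫ p_s(k) p_t(k⁻¹ g) dk`. [cite: DriverCMP1989, §4] -/
theorem integral_heatKernel_mul_heatKernel {p : ℝ → G → ℝ} (hp : IsGroupHeatKernel p) {s t : ℝ}
    (hs : 0 < s) (ht : 0 < t) (x y x' y' : G) :
    ∫ h, p s (x * h * y) * p t (x' * h⁻¹ * y') ∂(haarProbability G) =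
      p (s + t) (y * x * y' * x') := by
  haveI := isMulLeftInvariant_haarProbability G
  have h1 : ∀ h : G, p s (x * h * y) = p s (y * x * h) := fun h => by
    rw [← hp.central s hs (x * h * y) y]
    congr 1
    group
  have h2 : ∀ h : G, p t (x' * h⁻¹ * y') = p t (h⁻¹ * y' * x') := fun h => by
    rw [← hp.central t ht (x' * h⁻¹ * y') x'⁻¹]
    congr 1
    group
  simp_rw [h1, h2]
  have h3 := integral_mul_left_eq_self
    (fun k : G => p s k * p t (k⁻¹ * (y * x * y' * x'))) (μ := haarProbability G) (y * x)
  simp only [mul_inv_rev] at h3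
  rw [hp.semigroup s t hs ht]
  rw [← h3]
  congr 1
  funext k
  congr 2
  group

/-- **Convolution move**, `ℝ≥0∞` form used under product integrals:
`∫⁻ ofReal (p_s(x h y)) * ofReal (p_t(x' h⁻¹ y')) dh = ofReal (p_{s+t}(y x y' x'))`. [cite: DriverCMP1989, §4] -/
theorem lintegral_heatKernel_mul_heatKernel {p : ℝ → G → ℝ} (hp : IsGroupHeatKernel p) {s t : ℝ}
    (hs : 0 < s) (ht : 0 < t) (x y x' y' : G) :
    ∫⁻ h, ENNReal.ofReal (p s (x * h * y)) * ENNReal.ofReal (p t (x' * h⁻¹ * y'))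
        ∂(haarProbability G) = ENNReal.ofReal (p (s + t) (y * x * y' * x')) := by
  have hcont : Continuous fun h : G => p s (x * h * y) * p t (x' * h⁻¹ * y') :=
    ((hp.continuous hs).comp (by fun_prop)).mul ((hp.continuous ht).comp (by fun_prop))
  have hnn : ∀ h : G, 0 ≤ p s (x * h * y) * p t (x' * h⁻¹ * y') := fun h =>
    mul_nonneg (hp.nonneg s hs _) (hp.nonneg t ht _)
  simp_rw [← ENNReal.ofReal_mul (hp.nonneg s hs _)]
  rw [← ofReal_integral_eq_lintegral_ofReal
    (hcont.integrable_of_hasCompactSupport (HasCompactSupport.of_compactSpace _))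
    (Eventually.of_forall hnn), integral_heatKernel_mul_heatKernel hp hs ht]

/-- `∫ p_t(h⁻¹ g) dh = 1`: inversion symmetry and left invariance. [folklore] -/
theorem integral_heatKernel_inv_mul {p : ℝ → G → ℝ} (hp : IsGroupHeatKernel p) {t : ℝ}
    (ht : 0 < t) (g : G) : ∫ h, p t (h⁻¹ * g) ∂(haarProbability G) = 1 := by
  haveI := isMulLeftInvariant_haarProbability G
  have h1 : ∀ h : G, p t (h⁻¹ * g) = p t (g⁻¹ * h) := fun h => by
    rw [← hp.symm t ht (h⁻¹ * g), mul_inv_rev, inv_inv]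
  simp_rw [h1]
  rw [integral_mul_left_eq_self (fun k : G => p t k) g⁻¹, hp.integral_eq_one t ht]

/-! ### Marginals over product Haar measure -/

section Marginal

variable {ι : Type*} [DecidableEq ι]

/-- A function of `ι → G` not depending on the coordinates in `s` is its own `s`-marginal
(the coordinate measures are probability measures). [folklore] -/
theorem lmarginal_eq_self_of_dependsOn {s : Finset ι} {f : (ι → G) → ℝ≥0∞}
    (hf : DependsOn f ((↑s : Set ι)ᶜ)) :
    (∫⋯∫⁻_s, f ∂fun _ : ι => haarProbability G) = f := by
  funext x
  rw [lmarginal]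
  have h : ∀ y : ∀ _ : ↥s, G, f (updateFinset x s y) = f x := fun y =>
    hf fun i hi => by
      simp only [Set.mem_compl_iff, Finset.mem_coe] at hi
      simp [updateFinset, hi]
  simp_rw [h, lintegral_const, measure_univ, mul_one]

/-- A factor not depending on the coordinates in `s` (and finite) comes out of the
`s`-marginal. [folklore] -/
theorem lmarginal_const_mul_of_dependsOn {s : Finset ι} {c f : (ι → G) → ℝ≥0∞}
    (hc : DependsOn c ((↑s : Set ι)ᶜ)) (hc' : ∀ x, c x ≠ ∞) :
    (∫⋯∫⁻_s, (fun x => c x * f x) ∂fun _ : ι => haarProbability G) =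
      fun x => c x * (∫⋯∫⁻_s, f ∂fun _ : ι => haarProbability G) x := by
  funext x
  simp only [lmarginal]
  have h : ∀ y : ∀ _ : ↥s, G, c (updateFinset x s y) = c x := fun y =>
    hc fun i hi => by
      simp only [Set.mem_compl_iff, Finset.mem_coe] at hi
      simp [updateFinset, hi]
  simp_rw [h]
  rw [lintegral_const_mul' _ _ (hc' x)]

/-- Equal `s`-marginals give equal integrals over the full product. [folklore] -/
theorem lintegral_eq_of_lmarginal_eq [Fintype ι] {s : Finset ι} {Φ Ψ : (ι → G) → ℝ≥0∞}
    (hΦ : Measurable Φ) (hΨ : Measurable Ψ)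
    (h : (∫⋯∫⁻_s, Φ ∂fun _ : ι => haarProbability G) =
      ∫⋯∫⁻_s, Ψ ∂fun _ : ι => haarProbability G) :
    ∫⁻ U, Φ U ∂Measure.pi (fun _ : ι => haarProbability G) =
      ∫⁻ U, Ψ U ∂Measure.pi (fun _ : ι => haarProbability G) := by
  rw [lintegral_eq_lmarginal_univ (1 : ι → G), lintegral_eq_lmarginal_univ (1 : ι → G),
    ← Finset.sdiff_union_of_subset (Finset.subset_univ s),
    lmarginal_union _ _ hΦ Finset.sdiff_disjoint, lmarginal_union _ _ hΨ Finset.sdiff_disjoint, h]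

/-- **Renaming move.** If `Φ` at `U` with coordinate `e` set to `x` equals `Φ'` with coordinate `e`
set to `x · r(U)` (a right translation of the `e`-variable by a quantity read off the other
coordinates), then `Φ` and `Φ'` have the same `{e}`-marginal (right invariance of Haar measure)
and hence the same integral. [folklore] -/
theorem lmarginal_singleton_eq_of_update_mul {e : ι} {Φ Φ' : (ι → G) → ℝ≥0∞}
    (r : (ι → G) → G) (h : ∀ U x, Φ (update U e x) = Φ' (update U e (x * r U))) :
    (∫⋯∫⁻_{e}, Φ ∂fun _ : ι => haarProbability G) =
      ∫⋯∫⁻_{e}, Φ' ∂fun _ : ι => haarProbability G := by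
  haveI := isMulRightInvariant_haarProbability G
  rw [lmarginal_singleton, lmarginal_singleton]
  funext U
  simp_rw [h U]
  exact lintegral_mul_right_eq_self (fun x => Φ' (update U e x)) (r U)

/-- **Renaming move**, integrated form. [folklore] -/
theorem lintegral_eq_of_update_mul [Fintype ι] {e : ι} {Φ Φ' : (ι → G) → ℝ≥0∞}
    (hΦ : Measurable Φ) (hΦ' : Measurable Φ') (r : (ι → G) → G)
    (h : ∀ U x, Φ (update U e x) = Φ' (update U e (x * r U))) :
    ∫⁻ U, Φ U ∂Measure.pi (fun _ : ι => haarProbability G) =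
      ∫⁻ U, Φ' U ∂Measure.pi (fun _ : ι => haarProbability G) :=
  lintegral_eq_of_lmarginal_eq hΦ hΦ' (lmarginal_singleton_eq_of_update_mul r h)

/-- Peeling one more coordinate `e ∉ s` off an iterated marginal whose `s`-marginal is known:
`(∫⋯∫⁻_(insert e s) Φ) U = ∫⁻ x, Ψ (update U e x)` when `∫⋯∫⁻_s Φ = Ψ`. [folklore] -/
theorem lmarginal_insert_of_eq {s : Finset ι} {e : ι} (he : e ∉ s) {Φ Ψ : (ι → G) → ℝ≥0∞}
    (hΦ : Measurable Φ) (h : (∫⋯∫⁻_s, Φ ∂fun _ : ι => haarProbability G) = Ψ) (U : ι → G) :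
    (∫⋯∫⁻_(insert e s), Φ ∂fun _ : ι => haarProbability G) U =
      ∫⁻ x, Ψ (update U e x) ∂(haarProbability G) := by
  rw [lmarginal_insert _ hΦ he, h]

end Marginal

end Literature.MathematicalPhysics.QuantumFieldTheory.YM2
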